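/-
Copyright (c) 2026 The decomp-a2c cell. All rights reserved.
Released under Apache 2.0 license as described in the file LICENSE.
-/
import Summits.AtomisticToContinuum.Crystallization.Theorems.ChartedZeroExcessLayeredLatticeLiouvilleWS

/-!
# ChartedZeroExcessLayeredLatticeLiouville — part WT «Bootstrap»: the `ϱ`-free window bootstrap — linearly growing chain fluxes force linearly
  growing profile increments, with a constant that does not see `ϱ`
  (decomp-a2c-lens-2, g58; helper of stmt-AtomisticToContinuum-26636, leaf (PC) `ProfileComparisonAt`; step §3(iii) of memo NODE-g58d with the
  maximiser over `I₆₄` of critic row 1007 (iii)(iv))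

THE BOOTSTRAP.  Let `d : ℤ → ℤ → E3`-profile increments `Δ k = d(k+1) − d k`, a centre layer `α₀`, an offset `A ≥ 1` and a range `3L'` (`L' ≥ 1`).  Suppose
* (flux data) `‖chainFlux T d n‖ ≤ C_h·(|n − α₀| + 1)·ε₁` for `|n − α₀| ≤ 6L'` (parts WQ + WR after the data identity of the comparison mode);
* (a priori) `‖Δ k‖ ≤ B₀` for `|k − α₀| ≤ 9L' + ⌊ϱ/c⌋₊`;
* (thresholds, all `ϱ`-free) `9408·M·K ≤ A³`, `12·M·S ≤ (A+2)²`, `1372·K·B₀ ≤ L'³·ε₁`, `S·B₀ ≤ L'²·ε₁`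
  (`M = modeConst`, `S = stabConst` of part WB at `δ = κ₀ − ε/2`, `K = kernelConst`).
Then `‖Δ k‖ ≤ 4M(C_h + 1)·(|k − α₀| + A)·ε₁` for every `k` with `|k − α₀| + A ≤ 3L'` (`bootstrap_increment_le`).

PROOF (critic row 1007 (iv)).  Maximise the ratio `Θ = ‖Δ k‖/((|k − α₀| + A)ε₁)` over the finite range `I = {|k − α₀| + A ≤ 3L'}` (`Finset.exists_max_image`);
at the maximiser `k₀` put `R = |k₀ − α₀| + A`, window `W = [k₀ − R, k₀ + R]`, block carrier `T_w = [k₀ − 2R, k₀ + 2R]`.  On `W` the chain flux is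
`≤ 2C_h R ε₁`; a far increment of the band of `n ∈ W` is either in `I` — then `‖Δ k‖ ≤ Θε₁(|n − k| + 2R)` (linear class) — or outside `I` — then
`|n − k| ≥ L'` and `‖Δ k‖ ≤ B₀` (bounded class); part WS turns this into `H = 2C_h R ε₁ + 196K(12Θε₁(R+1)⁻² + 7B₀L'⁻³)`.  On the ring `T_w ∖ W` the
increments are `≤ 3RΘε₁` (+ `B₀` only when `R ≥ L' + 1`, where `(R+2)⁻² ≤ L'⁻²`).  Part WB (`increment_le_local`) gives
`ΘRε₁ = ‖Δ k₀‖ ≤ M(H + S(R+2)⁻²D)`, and the thresholds absorb the two `Θ`-terms into `ΘRε₁/2` and the two `B₀`-terms into `2Mε₁`, whence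
`Θ ≤ 4M(C_h + 1)`.
Nothing here depends on `ϱ` except the admissible ranges.
-/

namespace Summit.AtomisticToContinuum.Crystallization.Theorems.ChartedZeroExcessLayeredLatticeLiouville

open Summit.AtomisticToContinuum.Crystallization.Theorems.ChartedPlanarOrderRigidityDoor (E3)
open Finset
open scoped InnerProductSpace RealInnerProductSpace BigOperators

noncomputable section Bootstrap

variable {c : ℝ} {a b : E3} {w : ℤ → E3}

/-! ### WT.1  The bootstrap -/

/-- ★★★ THE `ϱ`-FREE WINDOW BOOTSTRAP: linearly growing chain fluxes (`≤ C_h(|n − α₀| + 1)ε₁`) and an a-priori bound `B₀` beyond the range force the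
profile increments to grow at most linearly, `‖d(k+1) − d k‖ ≤ 4·modeConst·(C_h + 1)·(|k − α₀| + A)·ε₁` on `|k − α₀| + A ≤ 3L'`, under four `ϱ`-free
thresholds on `A` and `L'` (maximiser of the ratio over the range + WS far-band bound + WB window inverse). [this file, g58] -/
theorem bootstrap_increment_le (hc : 0 < c) (hL : IsLayeredCrystal c a b w) {κ₀ ε ϱ : ℝ} (hϱ : 0 ≤ ϱ) (hε : ε < 2 * κ₀)
    (hK : CoerciveZ (layeredKernel a b w) κ₀)
    (hT : ∀ φ : Cell 2 → ℤ → E3, HasFiniteSupport φ → Summable (tailFam ϱ a b w φ) ∧ ∑' x, tailFam ϱ a b w φ x ≤ ε * nnFormZ φ)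
    (d : ℤ → E3) {T : Finset ℤ} (α₀ : ℤ) {A L' : ℕ} (hA : 1 ≤ A) (hL' : 1 ≤ L') {Ch ε₁ B₀ : ℝ} (hCh : 0 ≤ Ch) (hε₁ : 0 < ε₁) (hB₀ : 0 ≤ B₀)
    (hTc : ∀ n : ℤ, (n - α₀).natAbs ≤ 6 * L' → Icc (n - ⌊ϱ / c⌋₊) (n + 1 + ⌊ϱ / c⌋₊) ⊆ T)
    (hCF : ∀ n : ℤ, (n - α₀).natAbs ≤ 6 * L' → ‖chainFlux ϱ a b w T d n‖ ≤ Ch * (((((n - α₀).natAbs : ℕ)) : ℝ) + 1) * ε₁)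
    (hBd : ∀ k : ℤ, (k - α₀).natAbs ≤ 9 * L' + ⌊ϱ / c⌋₊ → ‖d (k + 1) - d k‖ ≤ B₀)
    (hA1 : 9408 * modeConst c (κ₀ - ε / 2) * kernelConst c ≤ ((A : ℕ) : ℝ) ^ 3)
    (hA2 : 12 * modeConst c (κ₀ - ε / 2) * stabConst c (κ₀ - ε / 2) ≤ (((A : ℕ) : ℝ) + 2) ^ 2)
    (hL1 : 1372 * kernelConst c * B₀ ≤ ((L' : ℕ) : ℝ) ^ 3 * ε₁) (hL2 : stabConst c (κ₀ - ε / 2) * B₀ ≤ ((L' : ℕ) : ℝ) ^ 2 * ε₁)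
    {k : ℤ} (hk : (k - α₀).natAbs + A ≤ 3 * L') :
    ‖d (k + 1) - d k‖ ≤ 4 * modeConst c (κ₀ - ε / 2) * (Ch + 1) * (((((k - α₀).natAbs : ℕ)) : ℝ) + A) * ε₁ := by
  set M := modeConst c (κ₀ - ε / 2) with hM
  set S := stabConst c (κ₀ - ε / 2) with hS
  have hδ : 0 < κ₀ - ε / 2 := by linarith
  have hM0 : 0 ≤ M := modeConst_nonneg c hδ
  have hS0 : 0 ≤ S := stabConst_nonneg hc _
  have hK0 := kernelConst_nonneg hc
  have hL'r : (1 : ℝ) ≤ ((L' : ℕ) : ℝ) := by exact_mod_cast hL'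
  have hAr : (1 : ℝ) ≤ ((A : ℕ) : ℝ) := by exact_mod_cast hA
  -- the weights and the range
  set wt : ℤ → ℝ := fun j => (((((j - α₀).natAbs : ℕ)) : ℝ) + A) * ε₁ with hwt
  have hwpos : ∀ j, 0 < wt j := fun j => by positivity
  set I : Finset ℤ := (Icc (α₀ - 3 * L') (α₀ + 3 * L')).filter (fun j => (j - α₀).natAbs + A ≤ 3 * L') with hI
  have hmemI : ∀ j : ℤ, (j - α₀).natAbs + A ≤ 3 * L' → j ∈ I := fun j hj =>
    mem_filter.mpr ⟨by rw [mem_Icc]; omega, hj⟩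
  -- the maximiser of the ratio
  obtain ⟨k₀, hk₀I, hmax⟩ := exists_max_image I (fun j => ‖d (j + 1) - d j‖ / wt j) ⟨k, hmemI k hk⟩
  have hk₀ : (k₀ - α₀).natAbs + A ≤ 3 * L' := (mem_filter.mp hk₀I).2
  set Θ := ‖d (k₀ + 1) - d k₀‖ / wt k₀ with hΘ
  have hΘ0 : 0 ≤ Θ := div_nonneg (norm_nonneg _) (hwpos k₀).le
  have hrat : ∀ j : ℤ, (j - α₀).natAbs + A ≤ 3 * L' → ‖d (j + 1) - d j‖ ≤ Θ * wt j := fun j hj =>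
    (div_le_iff₀ (hwpos j)).mp (hmax j (hmemI j hj))
  have hat : ‖d (k₀ + 1) - d k₀‖ = Θ * wt k₀ := (div_mul_cancel₀ _ (hwpos k₀).ne').symm
  -- it suffices to bound the maximal ratio
  suffices hΘle : Θ ≤ 4 * M * (Ch + 1) by
    calc ‖d (k + 1) - d k‖ ≤ Θ * wt k := hrat k hk
      _ ≤ 4 * M * (Ch + 1) * wt k := mul_le_mul_of_nonneg_right hΘle (hwpos k).le
      _ = 4 * M * (Ch + 1) * (((((k - α₀).natAbs : ℕ)) : ℝ) + A) * ε₁ := by simp only [hwt]; ring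
  -- the window at the maximiser
  obtain ⟨R, hR⟩ : ∃ R : ℕ, R = (k₀ - α₀).natAbs + A := ⟨_, rfl⟩
  have hR1 : 1 ≤ R := by omega
  have hRr : (1 : ℝ) ≤ ((R : ℕ) : ℝ) := by exact_mod_cast hR1
  have hRA : ((A : ℕ) : ℝ) ≤ ((R : ℕ) : ℝ) := by exact_mod_cast (show A ≤ R by omega)
  have hRe : ((R : ℕ) : ℝ) = ((((k₀ - α₀).natAbs : ℕ)) : ℝ) + A := by rw [hR]; push_cast; ring
  have hX : ‖d (k₀ + 1) - d k₀‖ = Θ * R * ε₁ := by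
    rw [hat, hRe]
    simp only [hwt]
    ring
  have hΘε : 0 ≤ Θ * ε₁ := by positivity
  have hWT : Icc (k₀ - R) (k₀ + R) ⊆ Icc (k₀ - 2 * R) (k₀ + 2 * R) := fun x hx => by rw [mem_Icc] at hx ⊢; omega
  -- the far-band bound on the inner window (part WS)
  have hH : ∀ n ∈ Icc (k₀ - R) (k₀ + R), ‖blockApply (fluxBlock hc hL ϱ) (Icc (k₀ - 2 * R) (k₀ + 2 * R)) (fun j => d (j + 1) - d j) n‖ ≤
      2 * Ch * R * ε₁ + 196 * kernelConst c * (12 * (Θ * ε₁) * (((((R : ℕ) : ℝ)) + 1)⁻¹) ^ 2 + 7 * B₀ * ((((L' : ℕ) : ℝ))⁻¹) ^ 3) := by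
    intro n hn
    have hn' : (n - α₀).natAbs + A ≤ 2 * R := by rw [mem_Icc] at hn; omega
    have hn6 : (n - α₀).natAbs ≤ 6 * L' := by omega
    have hH₀ : ‖chainFlux ϱ a b w T d n‖ ≤ 2 * Ch * R * ε₁ := by
      refine (hCF n hn6).trans ?_
      have h2 : ((((n - α₀).natAbs : ℕ)) : ℝ) + 1 ≤ 2 * R := by exact_mod_cast (show (n - α₀).natAbs + 1 ≤ 2 * R by omega)
      calc Ch * (((((n - α₀).natAbs : ℕ)) : ℝ) + 1) * ε₁ ≤ Ch * (2 * R) * ε₁ :=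
            mul_le_mul_of_nonneg_right (mul_le_mul_of_nonneg_left h2 hCh) hε₁.le
        _ = 2 * Ch * R * ε₁ := by ring
    refine norm_blockApply_far_le hc hL d hL' hn (hTc n hn6) hΘε hB₀ hH₀ fun j hjb hjT => ?_
    have hfar := natAbs_ge_of_far hn hjT
    by_cases hjI : (j - α₀).natAbs + A ≤ 3 * L'
    · left
      have hcmp : (j - α₀).natAbs + A ≤ (n - j).natAbs + 2 * R := by rw [mem_Icc] at hn; omega
      have hcmp' : ((((j - α₀).natAbs : ℕ)) : ℝ) + A ≤ ((((n - j).natAbs : ℕ)) : ℝ) + 2 * R := by exact_mod_cast hcmp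
      calc ‖d (j + 1) - d j‖ ≤ Θ * wt j := hrat j hjI
        _ = Θ * ε₁ * (((((j - α₀).natAbs : ℕ)) : ℝ) + A) := by simp only [hwt]; ring
        _ ≤ Θ * ε₁ * (((((n - j).natAbs : ℕ)) : ℝ) + 2 * R) := mul_le_mul_of_nonneg_left hcmp' hΘε
    · right
      rw [mem_Icc] at hn hjb
      exact ⟨by omega, hBd j (by omega)⟩
  -- the KEY inequality at the maximiser (part WB on the ring, two cases for the ring bound)
  have hKEY : Θ * R * ε₁ ≤ M * (2 * Ch * R * ε₁ + 196 * kernelConst c * (12 * (Θ * ε₁) * (((((R : ℕ) : ℝ)) + 1)⁻¹) ^ 2 +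
      7 * B₀ * ((((L' : ℕ) : ℝ))⁻¹) ^ 3)) + M * (S * (((((R : ℕ) : ℝ)) + 2)⁻¹) ^ 2 * (3 * R * (Θ * ε₁))) +
      M * (S * B₀ * ((((L' : ℕ) : ℝ))⁻¹) ^ 2) := by
    have hring : ∀ j ∈ Icc (k₀ - 2 * R) (k₀ + 2 * R) \ Icc (k₀ - R) (k₀ + R), (j - α₀).natAbs + A ≤ 3 * L' → ‖d (j + 1) - d j‖ ≤ 3 * R * (Θ * ε₁) := by
      intro j hj hjI
      have h1 := (mem_sdiff.mp hj).1
      rw [mem_Icc] at h1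
      have hjR : (j - α₀).natAbs + A ≤ 3 * R := by omega
      have hjR' : ((((j - α₀).natAbs : ℕ)) : ℝ) + A ≤ 3 * R := by exact_mod_cast hjR
      calc ‖d (j + 1) - d j‖ ≤ Θ * wt j := hrat j hjI
        _ = Θ * ε₁ * (((((j - α₀).natAbs : ℕ)) : ℝ) + A) := by simp only [hwt]; ring
        _ ≤ Θ * ε₁ * (3 * R) := mul_le_mul_of_nonneg_left hjR' hΘε
        _ = 3 * R * (Θ * ε₁) := by ring
    have hslack : 0 ≤ M * (S * B₀ * ((((L' : ℕ) : ℝ))⁻¹) ^ 2) := by positivity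
    by_cases hcase : R ≤ L'
    · -- every layer of the block carrier lies in the range
      have hD : ∀ j ∈ Icc (k₀ - 2 * R) (k₀ + 2 * R) \ Icc (k₀ - R) (k₀ + R), ‖(fun j => d (j + 1) - d j) j‖ ≤ 3 * R * (Θ * ε₁) := by
        intro j hj
        have h1 := (mem_sdiff.mp hj).1
        rw [mem_Icc] at h1
        exact hring j hj (by omega)
      have hWB := increment_le_local hc hL hϱ hε hK hT hWT (fun j => d (j + 1) - d j) (by positivity) hH hD
      have hWB' : ‖d (k₀ + 1) - d k₀‖ ≤ M * (2 * Ch * R * ε₁ + 196 * kernelConst c * (12 * (Θ * ε₁) * (((((R : ℕ) : ℝ)) + 1)⁻¹) ^ 2 +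
          7 * B₀ * ((((L' : ℕ) : ℝ))⁻¹) ^ 3) + S * (((((R : ℕ) : ℝ)) + 2)⁻¹) ^ 2 * (3 * R * (Θ * ε₁))) := hWB
      rw [hX] at hWB'
      linarith [mul_add M (2 * Ch * R * ε₁ + 196 * kernelConst c * (12 * (Θ * ε₁) * (((((R : ℕ) : ℝ)) + 1)⁻¹) ^ 2 +
        7 * B₀ * ((((L' : ℕ) : ℝ))⁻¹) ^ 3)) (S * (((((R : ℕ) : ℝ)) + 2)⁻¹) ^ 2 * (3 * R * (Θ * ε₁)))]
    · -- the block carrier reaches beyond the range: the a-priori bound enters, damped by `(R+2)⁻² ≤ L'⁻²`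
      have hD : ∀ j ∈ Icc (k₀ - 2 * R) (k₀ + 2 * R) \ Icc (k₀ - R) (k₀ + R), ‖(fun j => d (j + 1) - d j) j‖ ≤ 3 * R * (Θ * ε₁) + B₀ := by
        intro j hj
        have h1 := (mem_sdiff.mp hj).1
        rw [mem_Icc] at h1
        by_cases hjI : (j - α₀).natAbs + A ≤ 3 * L'
        · exact (hring j hj hjI).trans (le_add_of_nonneg_right hB₀)
        · have hb := hBd j (by omega)
          have h3 : (0 : ℝ) ≤ 3 * R * (Θ * ε₁) := by positivity
          exact hb.trans (by linarith)
      have hWB := increment_le_local hc hL hϱ hε hK hT hWT (fun j => d (j + 1) - d j) (by positivity) hH hD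
      have hWB' : ‖d (k₀ + 1) - d k₀‖ ≤ M * (2 * Ch * R * ε₁ + 196 * kernelConst c * (12 * (Θ * ε₁) * (((((R : ℕ) : ℝ)) + 1)⁻¹) ^ 2 +
          7 * B₀ * ((((L' : ℕ) : ℝ))⁻¹) ^ 3) + S * (((((R : ℕ) : ℝ)) + 2)⁻¹) ^ 2 * (3 * R * (Θ * ε₁) + B₀)) := hWB
      rw [hX] at hWB'
      have hRL : ((L' : ℕ) : ℝ) ≤ ((R : ℕ) : ℝ) + 2 := by
        have h' : ((L' : ℕ) : ℝ) + 1 ≤ ((R : ℕ) : ℝ) := by exact_mod_cast (show L' + 1 ≤ R by omega)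
        linarith
      have hinv : (((((R : ℕ) : ℝ)) + 2)⁻¹) ^ 2 ≤ ((((L' : ℕ) : ℝ))⁻¹) ^ 2 :=
        pow_le_pow_left₀ (inv_nonneg.mpr (by positivity)) (inv_anti₀ (by positivity) hRL) 2
      have h5 : M * (S * (((((R : ℕ) : ℝ)) + 2)⁻¹) ^ 2 * B₀) ≤ M * (S * B₀ * ((((L' : ℕ) : ℝ))⁻¹) ^ 2) := by
        have h51 : S * B₀ * (((((R : ℕ) : ℝ)) + 2)⁻¹) ^ 2 ≤ S * B₀ * ((((L' : ℕ) : ℝ))⁻¹) ^ 2 := mul_le_mul_of_nonneg_left hinv (mul_nonneg hS0 hB₀)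
        have h52 := mul_le_mul_of_nonneg_left h51 hM0
        linarith [show M * (S * (((((R : ℕ) : ℝ)) + 2)⁻¹) ^ 2 * B₀) = M * (S * B₀ * (((((R : ℕ) : ℝ)) + 2)⁻¹) ^ 2) by ring]
      have hexp : M * (2 * Ch * R * ε₁ + 196 * kernelConst c * (12 * (Θ * ε₁) * (((((R : ℕ) : ℝ)) + 1)⁻¹) ^ 2 +
          7 * B₀ * ((((L' : ℕ) : ℝ))⁻¹) ^ 3) + S * (((((R : ℕ) : ℝ)) + 2)⁻¹) ^ 2 * (3 * R * (Θ * ε₁) + B₀)) =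
          M * (2 * Ch * R * ε₁ + 196 * kernelConst c * (12 * (Θ * ε₁) * (((((R : ℕ) : ℝ)) + 1)⁻¹) ^ 2 + 7 * B₀ * ((((L' : ℕ) : ℝ))⁻¹) ^ 3)) +
          M * (S * (((((R : ℕ) : ℝ)) + 2)⁻¹) ^ 2 * (3 * R * (Θ * ε₁))) + M * (S * (((((R : ℕ) : ℝ)) + 2)⁻¹) ^ 2 * B₀) := by ring
      linarith
  -- the four absorptions
  have t2 : M * (196 * kernelConst c * (12 * (Θ * ε₁) * (((((R : ℕ) : ℝ)) + 1)⁻¹) ^ 2)) ≤ Θ * R * ε₁ / 4 := by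
    have hR3 : ((A : ℕ) : ℝ) ^ 3 ≤ ((R : ℕ) : ℝ) * (((R : ℕ) : ℝ) + 1) ^ 2 := by
      calc ((A : ℕ) : ℝ) ^ 3 ≤ ((R : ℕ) : ℝ) ^ 3 := by gcongr
        _ ≤ ((R : ℕ) : ℝ) * (((R : ℕ) : ℝ) + 1) ^ 2 := by nlinarith
    have key : 2352 * M * kernelConst c * (((((R : ℕ) : ℝ)) + 1)⁻¹) ^ 2 ≤ R / 4 := by
      rw [inv_pow, ← one_div, mul_one_div, div_le_iff₀ (by positivity)]
      linarith
    calc M * (196 * kernelConst c * (12 * (Θ * ε₁) * (((((R : ℕ) : ℝ)) + 1)⁻¹) ^ 2))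
        = 2352 * M * kernelConst c * (((((R : ℕ) : ℝ)) + 1)⁻¹) ^ 2 * (Θ * ε₁) := by ring
      _ ≤ R / 4 * (Θ * ε₁) := mul_le_mul_of_nonneg_right key hΘε
      _ = Θ * R * ε₁ / 4 := by ring
  have t4 : M * (S * (((((R : ℕ) : ℝ)) + 2)⁻¹) ^ 2 * (3 * R * (Θ * ε₁))) ≤ Θ * R * ε₁ / 4 := by
    have hR2 : (((A : ℕ) : ℝ) + 2) ^ 2 ≤ (((R : ℕ) : ℝ) + 2) ^ 2 := by gcongr
    have key : 3 * M * S * (((((R : ℕ) : ℝ)) + 2)⁻¹) ^ 2 ≤ 1 / 4 := by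
      rw [inv_pow, ← one_div, mul_one_div, div_le_iff₀ (by positivity)]
      linarith
    calc M * (S * (((((R : ℕ) : ℝ)) + 2)⁻¹) ^ 2 * (3 * R * (Θ * ε₁))) = 3 * M * S * (((((R : ℕ) : ℝ)) + 2)⁻¹) ^ 2 * (R * (Θ * ε₁)) := by ring
      _ ≤ 1 / 4 * (R * (Θ * ε₁)) := mul_le_mul_of_nonneg_right key (by positivity)
      _ = Θ * R * ε₁ / 4 := by ring
  have t3 : M * (196 * kernelConst c * (7 * B₀ * ((((L' : ℕ) : ℝ))⁻¹) ^ 3)) ≤ M * ε₁ := by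
    have key : 1372 * kernelConst c * B₀ * ((((L' : ℕ) : ℝ))⁻¹) ^ 3 ≤ ε₁ := by
      rw [inv_pow, ← one_div, mul_one_div, div_le_iff₀ (by positivity)]
      linarith
    calc M * (196 * kernelConst c * (7 * B₀ * ((((L' : ℕ) : ℝ))⁻¹) ^ 3)) = M * (1372 * kernelConst c * B₀ * ((((L' : ℕ) : ℝ))⁻¹) ^ 3) := by ring
      _ ≤ M * ε₁ := mul_le_mul_of_nonneg_left key hM0
  have t5 : M * (S * B₀ * ((((L' : ℕ) : ℝ))⁻¹) ^ 2) ≤ M * ε₁ := by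
    have key : S * B₀ * ((((L' : ℕ) : ℝ))⁻¹) ^ 2 ≤ ε₁ := by
      rw [inv_pow, ← one_div, mul_one_div, div_le_iff₀ (by positivity)]
      linarith
    exact mul_le_mul_of_nonneg_left key hM0
  have hexp2 : M * (2 * Ch * R * ε₁ + 196 * kernelConst c * (12 * (Θ * ε₁) * (((((R : ℕ) : ℝ)) + 1)⁻¹) ^ 2 + 7 * B₀ * ((((L' : ℕ) : ℝ))⁻¹) ^ 3)) =
      M * (2 * Ch * R * ε₁) + M * (196 * kernelConst c * (12 * (Θ * ε₁) * (((((R : ℕ) : ℝ)) + 1)⁻¹) ^ 2)) +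
      M * (196 * kernelConst c * (7 * B₀ * ((((L' : ℕ) : ℝ))⁻¹) ^ 3)) := by ring
  have hfin : Θ * R * ε₁ ≤ 4 * (M * (Ch * R * ε₁)) + 4 * (M * ε₁) := by linarith [hKEY, t2, t3, t4, t5, hexp2]
  -- divide by `R ε₁ > 0`
  have hRε : 0 < ((R : ℕ) : ℝ) * ε₁ := by positivity
  have h4 : 4 * (M * ε₁) ≤ 4 * (M * ε₁) * R := by
    have h' : 4 * (M * ε₁) * 1 ≤ 4 * (M * ε₁) * R := mul_le_mul_of_nonneg_left hRr (by positivity)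
    linarith
  have hmul : Θ * (((R : ℕ) : ℝ) * ε₁) ≤ 4 * M * (Ch + 1) * (((R : ℕ) : ℝ) * ε₁) := by
    have e1 : Θ * (((R : ℕ) : ℝ) * ε₁) = Θ * R * ε₁ := by ring
    have e2 : 4 * M * (Ch + 1) * (((R : ℕ) : ℝ) * ε₁) = 4 * (M * (Ch * R * ε₁)) + 4 * (M * ε₁) * R := by ring
    rw [e1, e2]
    linarith
  exact le_of_mul_le_mul_right hmul hRε

/-! ### WT.2  The closed statement of this part -/

/-- The content of part WT as one closed proposition: the `ϱ`-free window bootstrap. -/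
def BootstrapShape : Prop :=
  ∀ c : ℝ, ∀ hc : 0 < c, ∀ (a b : E3) (w : ℤ → E3), ∀ hL : IsLayeredCrystal c a b w, ∀ κ₀ ε ϱ : ℝ, 0 ≤ ϱ → ε < 2 * κ₀ →
    CoerciveZ (layeredKernel a b w) κ₀ →
    (∀ φ : Cell 2 → ℤ → E3, HasFiniteSupport φ → Summable (tailFam ϱ a b w φ) ∧ ∑' x, tailFam ϱ a b w φ x ≤ ε * nnFormZ φ) →
    ∀ (d : ℤ → E3) (T : Finset ℤ) (α₀ : ℤ) (A L' : ℕ), 1 ≤ A → 1 ≤ L' → ∀ Ch ε₁ B₀ : ℝ, 0 ≤ Ch → 0 < ε₁ → 0 ≤ B₀ →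
      (∀ n : ℤ, (n - α₀).natAbs ≤ 6 * L' → Icc (n - ⌊ϱ / c⌋₊) (n + 1 + ⌊ϱ / c⌋₊) ⊆ T) →
      (∀ n : ℤ, (n - α₀).natAbs ≤ 6 * L' → ‖chainFlux ϱ a b w T d n‖ ≤ Ch * (((((n - α₀).natAbs : ℕ)) : ℝ) + 1) * ε₁) →
      (∀ k : ℤ, (k - α₀).natAbs ≤ 9 * L' + ⌊ϱ / c⌋₊ → ‖d (k + 1) - d k‖ ≤ B₀) →
      9408 * modeConst c (κ₀ - ε / 2) * kernelConst c ≤ ((A : ℕ) : ℝ) ^ 3 →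
      12 * modeConst c (κ₀ - ε / 2) * stabConst c (κ₀ - ε / 2) ≤ (((A : ℕ) : ℝ) + 2) ^ 2 →
      1372 * kernelConst c * B₀ ≤ ((L' : ℕ) : ℝ) ^ 3 * ε₁ → stabConst c (κ₀ - ε / 2) * B₀ ≤ ((L' : ℕ) : ℝ) ^ 2 * ε₁ →
      ∀ k : ℤ, (k - α₀).natAbs + A ≤ 3 * L' →
        ‖d (k + 1) - d k‖ ≤ 4 * modeConst c (κ₀ - ε / 2) * (Ch + 1) * (((((k - α₀).natAbs : ℕ)) : ℝ) + A) * ε₁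

/-- WT holds. [this file, g58] -/
theorem bootstrapShape_holds : BootstrapShape :=
  fun _c hc _a _b _w hL _κ₀ _ε _ϱ hϱ hε hK hT d _T α₀ _A _L' hA hL' _Ch _ε₁ _B₀ hCh hε₁ hB₀ hTc hCF hBd hA1 hA2 hL1 hL2 _k hk =>
    bootstrap_increment_le hc hL hϱ hε hK hT d α₀ hA hL' hCh hε₁ hB₀ hTc hCF hBd hA1 hA2 hL1 hL2 hk

end Bootstrap

end Summit.AtomisticToContinuum.Crystallization.Theorems.ChartedZeroExcessLayeredLatticeLiouville
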